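import Summits.QuantumAdvantage.QuantumAdvantage.Theorems.CubicForrelationNearExactIsExactCubicFormR4ZAffine

/-!
# Crux `CubicForrelation.NearExactIsExact` (stmt-QuantumAdvantage-14043) — E1280-even, R4 branch, descendant `0` (`HZ`): quadratics on `𝔽₂⁴`
  in polynomial form, and the quadratics vanishing on a six-point hyperplane section of `Z₁₀`

Certificate seat `b2b-cforr-cert` (gen 43).  HONEST FRAMING: kernel-checked elementary lemmas (standard axioms) for the leaf entry of the
descendant `t̄₇ = 0` (E1280-HANDPROOFS §2.4 (i) "normal form": the linear parts `ℓ_v` of the cells are quadratic in `v` and vanish on the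
six zero cells `Z = Z₁₀ ∩ {α = 0}`, so their quadratic parts lie in `Π_Z = {ε·ω + a ∧ m}`).
* `tq0_form_lin`: the form `B(v, e_j)` of a quadratic on `𝔽₂⁴` is `⊕_t v_t B(e_t, e_j)`.
* `tq0_quad_poly`: a function on `𝔽₂⁴` with base-point free second differences `B` is the polynomial
  `q(0) ⊕ Σ_t v_t (q(0) ⊕ q(e_t)) ⊕ Σ_{s<t} v_s v_t B(e_s, e_t)`.
* `tq0_quad_six_core` (`decide`): a quadratic polynomial vanishing on `Z₁₀ ∩ {α = 0}` for a six-point-type affine `α = e₀e₁⊕e₂e₃ ⊕ Σ vₜeₜ`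
  has quadratic coefficients `q_{st} = ε·ω_{st} ⊕ e_s m_t ⊕ e_t m_s` (`ω = v₀v₁ + v₂v₃`).
Nothing about `θ₁₂`; NOT summit progress.

References: this seat lineage (g39 HANDPROOFS §2.4 (i), g43 LEAN-GEN43).  Axioms: the standard three.
-/

set_option linter.dupNamespace false -- D-0017: single-problem summit ⇒ `QuantumAdvantage.QuantumAdvantage` by design
set_option synthInstance.maxSize 8192
set_option synthInstance.maxHeartbeats 200000

namespace Summit.QuantumAdvantage.QuantumAdvantage.Theorems.CubicForrelation.NearExactIsExact

open Finset
open Literature.Computability.QuantumComplexity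
open Literature.Computability.QuantumComplexity.BuzetChailloux (bxor zeroVec bxor_comm bxor_self bxor_zeroVec zeroVec_bxor
  bxor_bxor_cancel_left)

section Poly

variable (q : (Fin 4 → Bool) → Bool) (B : (Fin 4 → Bool) → (Fin 4 → Bool) → Bool)
  (hB : ∀ s t x, ((q x ^^ q (bxor x t)) ^^ (q (bxor x s) ^^ q (bxor (bxor x s) t))) = B s t)
include hB

/-- **The form is linear in the first slot**: `B(v, e_j) = ⊕_t v_t B(e_t, e_j)`. [folklore] -/
theorem tq0_form_lin (v : Fin 4 → Bool) (j : Fin 4) :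
    B v (fun l => decide (l = j)) =
      ((((v 0 && B (fun l => decide (l = (0 : Fin 4))) (fun l => decide (l = j))) ^^ (v 1 && B (fun l => decide (l = (1 : Fin 4))) (fun l => decide (l = j)))) ^^
        (v 2 && B (fun l => decide (l = (2 : Fin 4))) (fun l => decide (l = j)))) ^^ (v 3 && B (fun l => decide (l = (3 : Fin 4))) (fun l => decide (l = j)))) := by
  obtain ⟨-, hadd, -, -⟩ := tcb_form_basic q B hB
  have h0 : B zeroVec (fun l => decide (l = j)) = false := by
    have e := hadd zeroVec zeroVec (fun l => decide (l = j))
    rw [bxor_self] at e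
    revert e; cases B zeroVec (fun l => decide (l = j)) <;> decide
  revert v
  refine tq0_units_induction _ ?_ ?_
  · rw [h0]; rfl
  · intro x i hx
    rw [hadd, hx]
    have hi : i = 0 ∨ i = 1 ∨ i = 2 ∨ i = 3 := by fin_cases i <;> simp
    have d01 : decide ((0 : Fin 4) = (1 : Fin 4)) = false := by decide
    have d02 : decide ((0 : Fin 4) = (2 : Fin 4)) = false := by decide
    have d03 : decide ((0 : Fin 4) = (3 : Fin 4)) = false := by decide
    have d10 : decide ((1 : Fin 4) = (0 : Fin 4)) = false := by decide
    have d12 : decide ((1 : Fin 4) = (2 : Fin 4)) = false := by decide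
    have d13 : decide ((1 : Fin 4) = (3 : Fin 4)) = false := by decide
    have d20 : decide ((2 : Fin 4) = (0 : Fin 4)) = false := by decide
    have d21 : decide ((2 : Fin 4) = (1 : Fin 4)) = false := by decide
    have d23 : decide ((2 : Fin 4) = (3 : Fin 4)) = false := by decide
    have d30 : decide ((3 : Fin 4) = (0 : Fin 4)) = false := by decide
    have d31 : decide ((3 : Fin 4) = (1 : Fin 4)) = false := by decide
    have d32 : decide ((3 : Fin 4) = (2 : Fin 4)) = false := by decide
    rcases hi with rfl | rfl | rfl | rfl
    · simp only [bxor, d10, d20, d30]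
      generalize B (fun l => decide (l = (0 : Fin 4))) (fun l => decide (l = j)) = b0
      generalize B (fun l => decide (l = (1 : Fin 4))) (fun l => decide (l = j)) = b1
      generalize B (fun l => decide (l = (2 : Fin 4))) (fun l => decide (l = j)) = b2
      generalize B (fun l => decide (l = (3 : Fin 4))) (fun l => decide (l = j)) = b3
      generalize x 0 = x0; generalize x 1 = x1; generalize x 2 = x2; generalize x 3 = x3
      revert b0 b1 b2 b3 x0 x1 x2 x3; decide +kernel
    · simp only [bxor, d01, d21, d31]
      generalize B (fun l => decide (l = (0 : Fin 4))) (fun l => decide (l = j)) = b0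
      generalize B (fun l => decide (l = (1 : Fin 4))) (fun l => decide (l = j)) = b1
      generalize B (fun l => decide (l = (2 : Fin 4))) (fun l => decide (l = j)) = b2
      generalize B (fun l => decide (l = (3 : Fin 4))) (fun l => decide (l = j)) = b3
      generalize x 0 = x0; generalize x 1 = x1; generalize x 2 = x2; generalize x 3 = x3
      revert b0 b1 b2 b3 x0 x1 x2 x3; decide +kernel
    · simp only [bxor, d02, d12, d32]
      generalize B (fun l => decide (l = (0 : Fin 4))) (fun l => decide (l = j)) = b0
      generalize B (fun l => decide (l = (1 : Fin 4))) (fun l => decide (l = j)) = b1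
      generalize B (fun l => decide (l = (2 : Fin 4))) (fun l => decide (l = j)) = b2
      generalize B (fun l => decide (l = (3 : Fin 4))) (fun l => decide (l = j)) = b3
      generalize x 0 = x0; generalize x 1 = x1; generalize x 2 = x2; generalize x 3 = x3
      revert b0 b1 b2 b3 x0 x1 x2 x3; decide +kernel
    · simp only [bxor, d03, d13, d23]
      generalize B (fun l => decide (l = (0 : Fin 4))) (fun l => decide (l = j)) = b0
      generalize B (fun l => decide (l = (1 : Fin 4))) (fun l => decide (l = j)) = b1
      generalize B (fun l => decide (l = (2 : Fin 4))) (fun l => decide (l = j)) = b2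
      generalize B (fun l => decide (l = (3 : Fin 4))) (fun l => decide (l = j)) = b3
      generalize x 0 = x0; generalize x 1 = x1; generalize x 2 = x2; generalize x 3 = x3
      revert b0 b1 b2 b3 x0 x1 x2 x3; decide +kernel

/-- **Polynomial form of a quadratic on `𝔽₂⁴`.** [folklore] -/
theorem tq0_quad_poly (v : Fin 4 → Bool) :
    q v = (q zeroVec ^^ ((v 0 && (q zeroVec ^^ q (fun l => decide (l = (0 : Fin 4))))) ^^ (v 1 && (q zeroVec ^^ q (fun l => decide (l = (1 : Fin 4))))) ^^ (v 2 && (q zeroVec ^^ q (fun l => decide (l = (2 : Fin 4))))) ^^ (v 3 && (q zeroVec ^^ q (fun l => decide (l = (3 : Fin 4)))))) ^^ (((v 0 && v 1) && B (fun l => decide (l = (0 : Fin 4))) (fun l => decide (l = (1 : Fin 4)))) ^^ ((v 0 && v 2) && B (fun l => decide (l = (0 : Fin 4))) (fun l => decide (l = (2 : Fin 4)))) ^^ ((v 0 && v 3) && B (fun l => decide (l = (0 : Fin 4))) (fun l => decide (l = (3 : Fin 4)))) ^^ ((v 1 && v 2) && B (fun l => decide (l = (1 : Fin 4))) (fun l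 => decide (l = (2 : Fin 4)))) ^^ ((v 1 && v 3) && B (fun l => decide (l = (1 : Fin 4))) (fun l => decide (l = (3 : Fin 4)))) ^^ ((v 2 && v 3) && B (fun l => decide (l = (2 : Fin 4))) (fun l => decide (l = (3 : Fin 4)))))) := by
  obtain ⟨hsymm, hadd, halt, htr⟩ := tcb_form_basic q B hB
  revert v
  refine tq0_units_induction _ ?_ ?_
  · simp [zeroVec]
  · intro x i hx
    rw [htr x, hx, tq0_form_lin q B hB x i]
    have hi : i = 0 ∨ i = 1 ∨ i = 2 ∨ i = 3 := by fin_cases i <;> simp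
    have d01 : decide ((0 : Fin 4) = (1 : Fin 4)) = false := by decide
    have d02 : decide ((0 : Fin 4) = (2 : Fin 4)) = false := by decide
    have d03 : decide ((0 : Fin 4) = (3 : Fin 4)) = false := by decide
    have d10 : decide ((1 : Fin 4) = (0 : Fin 4)) = false := by decide
    have d12 : decide ((1 : Fin 4) = (2 : Fin 4)) = false := by decide
    have d13 : decide ((1 : Fin 4) = (3 : Fin 4)) = false := by decide
    have d20 : decide ((2 : Fin 4) = (0 : Fin 4)) = false := by decide
    have d21 : decide ((2 : Fin 4) = (1 : Fin 4)) = false := by decide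
    have d23 : decide ((2 : Fin 4) = (3 : Fin 4)) = false := by decide
    have d30 : decide ((3 : Fin 4) = (0 : Fin 4)) = false := by decide
    have d31 : decide ((3 : Fin 4) = (1 : Fin 4)) = false := by decide
    have d32 : decide ((3 : Fin 4) = (2 : Fin 4)) = false := by decide
    rcases hi with rfl | rfl | rfl | rfl
    · rw [hsymm (fun l => decide (l = (1 : Fin 4))) (fun l => decide (l = (0 : Fin 4))), hsymm (fun l => decide (l = (2 : Fin 4))) (fun l => decide (l = (0 : Fin 4))), hsymm (fun l => decide (l = (3 : Fin 4))) (fun l => decide (l = (0 : Fin 4))), halt (fun l => decide (l = (0 : Fin 4)))]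
      simp only [bxor, d10, d20, d30]
      generalize q zeroVec = c
      generalize q (fun l => decide (l = (0 : Fin 4))) = a0
      generalize q (fun l => decide (l = (1 : Fin 4))) = a1
      generalize q (fun l => decide (l = (2 : Fin 4))) = a2
      generalize q (fun l => decide (l = (3 : Fin 4))) = a3
      generalize B (fun l => decide (l = (0 : Fin 4))) (fun l => decide (l = (1 : Fin 4))) = b01
      generalize B (fun l => decide (l = (0 : Fin 4))) (fun l => decide (l = (2 : Fin 4))) = b02
      generalize B (fun l => decide (l = (0 : Fin 4))) (fun l => decide (l = (3 : Fin 4))) = b03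
      generalize B (fun l => decide (l = (1 : Fin 4))) (fun l => decide (l = (2 : Fin 4))) = b12
      generalize B (fun l => decide (l = (1 : Fin 4))) (fun l => decide (l = (3 : Fin 4))) = b13
      generalize B (fun l => decide (l = (2 : Fin 4))) (fun l => decide (l = (3 : Fin 4))) = b23
      generalize x 0 = x0; generalize x 1 = x1; generalize x 2 = x2; generalize x 3 = x3
      revert c a0 a1 a2 a3 b01 b02 b03 b12 b13 b23 x0 x1 x2 x3; decide +kernel
    · rw [hsymm (fun l => decide (l = (2 : Fin 4))) (fun l => decide (l = (1 : Fin 4))), hsymm (fun l => decide (l = (3 : Fin 4))) (fun l => decide (l = (1 : Fin 4))), halt (fun l => decide (l = (1 : Fin 4)))]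
      simp only [bxor, d01, d21, d31]
      generalize q zeroVec = c
      generalize q (fun l => decide (l = (0 : Fin 4))) = a0
      generalize q (fun l => decide (l = (1 : Fin 4))) = a1
      generalize q (fun l => decide (l = (2 : Fin 4))) = a2
      generalize q (fun l => decide (l = (3 : Fin 4))) = a3
      generalize B (fun l => decide (l = (0 : Fin 4))) (fun l => decide (l = (1 : Fin 4))) = b01
      generalize B (fun l => decide (l = (0 : Fin 4))) (fun l => decide (l = (2 : Fin 4))) = b02
      generalize B (fun l => decide (l = (0 : Fin 4))) (fun l => decide (l = (3 : Fin 4))) = b03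
      generalize B (fun l => decide (l = (1 : Fin 4))) (fun l => decide (l = (2 : Fin 4))) = b12
      generalize B (fun l => decide (l = (1 : Fin 4))) (fun l => decide (l = (3 : Fin 4))) = b13
      generalize B (fun l => decide (l = (2 : Fin 4))) (fun l => decide (l = (3 : Fin 4))) = b23
      generalize x 0 = x0; generalize x 1 = x1; generalize x 2 = x2; generalize x 3 = x3
      revert c a0 a1 a2 a3 b01 b02 b03 b12 b13 b23 x0 x1 x2 x3; decide +kernel
    · rw [hsymm (fun l => decide (l = (3 : Fin 4))) (fun l => decide (l = (2 : Fin 4))), halt (fun l => decide (l = (2 : Fin 4)))]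
      simp only [bxor, d02, d12, d32]
      generalize q zeroVec = c
      generalize q (fun l => decide (l = (0 : Fin 4))) = a0
      generalize q (fun l => decide (l = (1 : Fin 4))) = a1
      generalize q (fun l => decide (l = (2 : Fin 4))) = a2
      generalize q (fun l => decide (l = (3 : Fin 4))) = a3
      generalize B (fun l => decide (l = (0 : Fin 4))) (fun l => decide (l = (1 : Fin 4))) = b01
      generalize B (fun l => decide (l = (0 : Fin 4))) (fun l => decide (l = (2 : Fin 4))) = b02
      generalize B (fun l => decide (l = (0 : Fin 4))) (fun l => decide (l = (3 : Fin 4))) = b03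
      generalize B (fun l => decide (l = (1 : Fin 4))) (fun l => decide (l = (2 : Fin 4))) = b12
      generalize B (fun l => decide (l = (1 : Fin 4))) (fun l => decide (l = (3 : Fin 4))) = b13
      generalize B (fun l => decide (l = (2 : Fin 4))) (fun l => decide (l = (3 : Fin 4))) = b23
      generalize x 0 = x0; generalize x 1 = x1; generalize x 2 = x2; generalize x 3 = x3
      revert c a0 a1 a2 a3 b01 b02 b03 b12 b13 b23 x0 x1 x2 x3; decide +kernel
    · rw [halt (fun l => decide (l = (3 : Fin 4)))]
      simp only [bxor, d03, d13, d23]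
      generalize q zeroVec = c
      generalize q (fun l => decide (l = (0 : Fin 4))) = a0
      generalize q (fun l => decide (l = (1 : Fin 4))) = a1
      generalize q (fun l => decide (l = (2 : Fin 4))) = a2
      generalize q (fun l => decide (l = (3 : Fin 4))) = a3
      generalize B (fun l => decide (l = (0 : Fin 4))) (fun l => decide (l = (1 : Fin 4))) = b01
      generalize B (fun l => decide (l = (0 : Fin 4))) (fun l => decide (l = (2 : Fin 4))) = b02
      generalize B (fun l => decide (l = (0 : Fin 4))) (fun l => decide (l = (3 : Fin 4))) = b03
      generalize B (fun l => decide (l = (1 : Fin 4))) (fun l => decide (l = (2 : Fin 4))) = b12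
      generalize B (fun l => decide (l = (1 : Fin 4))) (fun l => decide (l = (3 : Fin 4))) = b13
      generalize B (fun l => decide (l = (2 : Fin 4))) (fun l => decide (l = (3 : Fin 4))) = b23
      generalize x 0 = x0; generalize x 1 = x1; generalize x 2 = x2; generalize x 3 = x3
      revert c a0 a1 a2 a3 b01 b02 b03 b12 b13 b23 x0 x1 x2 x3; decide +kernel

end Poly

/-- **Quadratics vanishing on a six-point hyperplane section of `Z₁₀`**, explicit form (`decide`): if the affine function
`α(v) = e₀e₁ ⊕ e₂e₃ ⊕ Σ vₜeₜ` (six-point type) is nonconstant and the quadratic polynomial `c ⊕ Σ lₜvₜ ⊕ Σ q_{st} v_s v_t` vanishes at the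
points of `Z₁₀` where `α = 0`, then `q_{st} = ε·ω_{st} ⊕ e_s m_t ⊕ e_t m_s` for explicit `ε, m` (`ω_{01} = ω_{23} = 1`). [this work] -/
theorem tq0_quad_six_explicit : ∀ (e0 e1 e2 e3 : Bool), (e0 || e1 || e2 || e3) = true →
    ∀ (c l0 l1 l2 l3 q01 q02 q03 q12 q13 q23 : Bool),
    (((((e0 && e1) ^^ (e2 && e3)) ^^ (false && e0)) ^^ (false && e1) ^^ (false && e2) ^^ (false && e3)) = false → (c ^^ ((false && l0) ^^ (false && l1) ^^ (false && l2) ^^ (false && l3)) ^^ (((false && false) && q01) ^^ ((false && false) && q02) ^^ ((false && false) && q03) ^^ ((false && false) && q12) ^^ ((false && false) && q13) ^^ ((false && false) && q23))) = false) →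
    (((((e0 && e1) ^^ (e2 && e3)) ^^ (false && e0)) ^^ (false && e1) ^^ (false && e2) ^^ (true && e3)) = false → (c ^^ ((false && l0) ^^ (false && l1) ^^ (false && l2) ^^ (true && l3)) ^^ (((false && false) && q01) ^^ ((false && false) && q02) ^^ ((false && true) && q03) ^^ ((false && false) && q12) ^^ ((false && true) && q13) ^^ ((false && true) && q23))) = false) →
    (((((e0 && e1) ^^ (e2 && e3)) ^^ (false && e0)) ^^ (false && e1) ^^ (true && e2) ^^ (false && e3)) = false → (c ^^ ((false && l0) ^^ (false && l1) ^^ (true && l2) ^^ (false && l3)) ^^ (((false && false) && q01) ^^ ((false && true) && q02) ^^ ((false && false) && q03) ^^ ((false && true) && q12) ^^ ((false && false) && q13) ^^ ((true && false) && q23))) = false) →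
    (((((e0 && e1) ^^ (e2 && e3)) ^^ (false && e0)) ^^ (true && e1) ^^ (false && e2) ^^ (false && e3)) = false → (c ^^ ((false && l0) ^^ (true && l1) ^^ (false && l2) ^^ (false && l3)) ^^ (((false && true) && q01) ^^ ((false && false) && q02) ^^ ((false && false) && q03) ^^ ((true && false) && q12) ^^ ((true && false) && q13) ^^ ((false && false) && q23))) = false) →
    (((((e0 && e1) ^^ (e2 && e3)) ^^ (false && e0)) ^^ (true && e1) ^^ (false && e2) ^^ (true && e3)) = false → (c ^^ ((false && l0) ^^ (true && l1) ^^ (false && l2) ^^ (true && l3)) ^^ (((false && true) && q01) ^^ ((false && false) && q02) ^^ ((false && true) && q03) ^^ ((true && false) && q12) ^^ ((true && true) && q13) ^^ ((false && true) && q23))) = false) →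
    (((((e0 && e1) ^^ (e2 && e3)) ^^ (false && e0)) ^^ (true && e1) ^^ (true && e2) ^^ (false && e3)) = false → (c ^^ ((false && l0) ^^ (true && l1) ^^ (true && l2) ^^ (false && l3)) ^^ (((false && true) && q01) ^^ ((false && true) && q02) ^^ ((false && false) && q03) ^^ ((true && true) && q12) ^^ ((true && false) && q13) ^^ ((true && false) && q23))) = false) →
    (((((e0 && e1) ^^ (e2 && e3)) ^^ (true && e0)) ^^ (false && e1) ^^ (false && e2) ^^ (false && e3)) = false → (c ^^ ((true && l0) ^^ (false && l1) ^^ (false && l2) ^^ (false && l3)) ^^ (((true && false) && q01) ^^ ((true && false) && q02) ^^ ((true && false) && q03) ^^ ((false && false) && q12) ^^ ((false && false) && q13) ^^ ((false && false) && q23))) = false) →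
    (((((e0 && e1) ^^ (e2 && e3)) ^^ (true && e0)) ^^ (false && e1) ^^ (false && e2) ^^ (true && e3)) = false → (c ^^ ((true && l0) ^^ (false && l1) ^^ (false && l2) ^^ (true && l3)) ^^ (((true && false) && q01) ^^ ((true && false) && q02) ^^ ((true && true) && q03) ^^ ((false && false) && q12) ^^ ((false && true) && q13) ^^ ((false && true) && q23))) = false) →
    (((((e0 && e1) ^^ (e2 && e3)) ^^ (true && e0)) ^^ (false && e1) ^^ (true && e2) ^^ (false && e3)) = false → (c ^^ ((true && l0) ^^ (false && l1) ^^ (true && l2) ^^ (false && l3)) ^^ (((true && false) && q01) ^^ ((true && true) && q02) ^^ ((true && false) && q03) ^^ ((false && true) && q12) ^^ ((false && false) && q13) ^^ ((true && false) && q23))) = false) →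
    (((((e0 && e1) ^^ (e2 && e3)) ^^ (true && e0)) ^^ (true && e1) ^^ (true && e2) ^^ (true && e3)) = false → (c ^^ ((true && l0) ^^ (true && l1) ^^ (true && l2) ^^ (true && l3)) ^^ (((true && true) && q01) ^^ ((true && true) && q02) ^^ ((true && true) && q03) ^^ ((true && true) && q12) ^^ ((true && true) && q13) ^^ ((true && true) && q23))) = false) →
    q01 = (((bif e0 then (q23 ^^ (e2 && q03)) ^^ (e3 && q02) else bif e1 then (q23 ^^ (e2 && q13)) ^^ (e3 && q12) else q01) ^^ (e0 && (bif e0 then q01 ^^ (bif e0 then (q23 ^^ (e2 && q03)) ^^ (e3 && q02) else bif e1 then (q23 ^^ (e2 && q13)) ^^ (e3 && q12) else q01) else bif e1 then false else bif e2 then q12 else q13))) ^^ (e1 && (bif e0 then false else bif e1 then q01 ^^ (bif e0 then (q23 ^^ (e2 && q03)) ^^ (e3 && q02) else bif e1 then (q23 ^^ (e2 && q13)) ^^ (e3 && q12) else q01) else bif e2 then q02 else q03))) ∧ q02 = ((e0 && (bif e0 then q02 else bif e1 then q12 else bif e2 then false else q23 ^^ (bif e0 then (q23 ^^ (e2 &&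 q03)) ^^ (e3 && q02) else bif e1 then (q23 ^^ (e2 && q13)) ^^ (e3 && q12) else q01))) ^^ (e2 && (bif e0 then false else bif e1 then q01 ^^ (bif e0 then (q23 ^^ (e2 && q03)) ^^ (e3 && q02) else bif e1 then (q23 ^^ (e2 && q13)) ^^ (e3 && q12) else q01) else bif e2 then q02 else q03))) ∧ q03 = ((e0 && (bif e0 then q03 else bif e1 then q13 else bif e2 then q23 ^^ (bif e0 then (q23 ^^ (e2 && q03)) ^^ (e3 && q02) else bif e1 then (q23 ^^ (e2 && q13)) ^^ (e3 && q12) else q01) else false)) ^^ (e3 && (bif e0 then false else bif e1 then q01 ^^ (bif e0 then (q23 ^^ (e2 && q03)) ^^ (e3 && q02) else bif e1 then (q23 ^^ (e2 && q13)) ^^ (e3 && q12) else q01) else bif e2 then q02 else q03))) ∧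
      q12 = ((e1 && (bif e0 then q02 else bif e1 then q12 else bif e2 then false else q23 ^^ (bif e0 then (q23 ^^ (e2 && q03)) ^^ (e3 && q02) else bif e1 then (q23 ^^ (e2 && q13)) ^^ (e3 && q12) else q01))) ^^ (e2 && (bif e0 then q01 ^^ (bif e0 then (q23 ^^ (e2 && q03)) ^^ (e3 && q02) else bif e1 then (q23 ^^ (e2 && q13)) ^^ (e3 && q12) else q01) else bif e1 then false else bif e2 then q12 else q13))) ∧ q13 = ((e1 && (bif e0 then q03 else bif e1 then q13 else bif e2 then q23 ^^ (bif e0 then (q23 ^^ (e2 && q03)) ^^ (e3 && q02) else bif e1 then (q23 ^^ (e2 && q13)) ^^ (e3 && q12) else q01) else false)) ^^ (e3 && (bif e0 then q01 ^^ (bif e0 then (q23 ^^ (e2 && q03)) ^^ (e3 && q02) else bif e1 then (q23 ^^ (e2 && q13)) ^^ (e3 && q12) else q01) else bif e1 then false else bif e2 then q12 else q13))) ∧ q23 = (((bif e0 then (q23 ^^ (e2 && q03)) ^^ (e3 && q02) else bif e1 then (q23 ^^ (e2 && q13)) ^^ (e3 && q12) else q01) ^^ (e2 && (bif e0 then q03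 else bif e1 then q13 else bif e2 then q23 ^^ (bif e0 then (q23 ^^ (e2 && q03)) ^^ (e3 && q02) else bif e1 then (q23 ^^ (e2 && q13)) ^^ (e3 && q12) else q01) else false))) ^^ (e3 && (bif e0 then q02 else bif e1 then q12 else bif e2 then false else q23 ^^ (bif e0 then (q23 ^^ (e2 && q03)) ^^ (e3 && q02) else bif e1 then (q23 ^^ (e2 && q13)) ^^ (e3 && q12) else q01)))) := by
  intro e0 e1 e2 e3
  cases e0 <;> cases e1 <;> cases e2 <;> cases e3 <;> decide +kernel

/-- **Quadratics vanishing on a six-point hyperplane section of `Z₁₀`**: existence form of `tq0_quad_six_explicit`. [this work] -/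
theorem tq0_quad_six_core (e0 e1 e2 e3 : Bool) (hA : (e0 || e1 || e2 || e3) = true)
    (c l0 l1 l2 l3 q01 q02 q03 q12 q13 q23 : Bool)
    (h0 : ((((e0 && e1) ^^ (e2 && e3)) ^^ (false && e0)) ^^ (false && e1) ^^ (false && e2) ^^ (false && e3)) = false → (c ^^ ((false && l0) ^^ (false && l1) ^^ (false && l2) ^^ (false && l3)) ^^ (((false && false) && q01) ^^ ((false && false) && q02) ^^ ((false && false) && q03) ^^ ((false && false) && q12) ^^ ((false && false) && q13) ^^ ((false && false) && q23))) = false)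
    (h1 : ((((e0 && e1) ^^ (e2 && e3)) ^^ (false && e0)) ^^ (false && e1) ^^ (false && e2) ^^ (true && e3)) = false → (c ^^ ((false && l0) ^^ (false && l1) ^^ (false && l2) ^^ (true && l3)) ^^ (((false && false) && q01) ^^ ((false && false) && q02) ^^ ((false && true) && q03) ^^ ((false && false) && q12) ^^ ((false && true) && q13) ^^ ((false && true) && q23))) = false)
    (h2 : ((((e0 && e1) ^^ (e2 && e3)) ^^ (false && e0)) ^^ (false && e1) ^^ (true && e2) ^^ (false && e3)) = false → (c ^^ ((false && l0) ^^ (false && l1) ^^ (true && l2) ^^ (false && l3)) ^^ (((false && false) && q01) ^^ ((false && true) && q02) ^^ ((false && false) && q03) ^^ ((false && true) && q12) ^^ ((false && false) && q13) ^^ ((true && false) && q23))) = false)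
    (h3 : ((((e0 && e1) ^^ (e2 && e3)) ^^ (false && e0)) ^^ (true && e1) ^^ (false && e2) ^^ (false && e3)) = false → (c ^^ ((false && l0) ^^ (true && l1) ^^ (false && l2) ^^ (false && l3)) ^^ (((false && true) && q01) ^^ ((false && false) && q02) ^^ ((false && false) && q03) ^^ ((true && false) && q12) ^^ ((true && false) && q13) ^^ ((false && false) && q23))) = false)
    (h4 : ((((e0 && e1) ^^ (e2 && e3)) ^^ (false && e0)) ^^ (true && e1) ^^ (false && e2) ^^ (true && e3)) = false → (c ^^ ((false && l0) ^^ (true && l1) ^^ (false && l2) ^^ (true && l3)) ^^ (((false && true) && q01) ^^ ((false && false) && q02) ^^ ((false && true) && q03) ^^ ((true && false) && q12) ^^ ((true && true) && q13) ^^ ((false && true) && q23))) = false)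
    (h5 : ((((e0 && e1) ^^ (e2 && e3)) ^^ (false && e0)) ^^ (true && e1) ^^ (true && e2) ^^ (false && e3)) = false → (c ^^ ((false && l0) ^^ (true && l1) ^^ (true && l2) ^^ (false && l3)) ^^ (((false && true) && q01) ^^ ((false && true) && q02) ^^ ((false && false) && q03) ^^ ((true && true) && q12) ^^ ((true && false) && q13) ^^ ((true && false) && q23))) = false)
    (h6 : ((((e0 && e1) ^^ (e2 && e3)) ^^ (true && e0)) ^^ (false && e1) ^^ (false && e2) ^^ (false && e3)) = false → (c ^^ ((true && l0) ^^ (false && l1) ^^ (false && l2) ^^ (false && l3)) ^^ (((true && false) && q01) ^^ ((true && false) && q02) ^^ ((true && false) && q03) ^^ ((false && false) && q12) ^^ ((false && false) && q13) ^^ ((false && false) && q23))) = false)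
    (h7 : ((((e0 && e1) ^^ (e2 && e3)) ^^ (true && e0)) ^^ (false && e1) ^^ (false && e2) ^^ (true && e3)) = false → (c ^^ ((true && l0) ^^ (false && l1) ^^ (false && l2) ^^ (true && l3)) ^^ (((true && false) && q01) ^^ ((true && false) && q02) ^^ ((true && true) && q03) ^^ ((false && false) && q12) ^^ ((false && true) && q13) ^^ ((false && true) && q23))) = false)
    (h8 : ((((e0 && e1) ^^ (e2 && e3)) ^^ (true && e0)) ^^ (false && e1) ^^ (true && e2) ^^ (false && e3)) = false → (c ^^ ((true && l0) ^^ (false && l1) ^^ (true && l2) ^^ (false && l3)) ^^ (((true && false) && q01) ^^ ((true && true) && q02) ^^ ((true && false) && q03) ^^ ((false && true) && q12) ^^ ((false && false) && q13) ^^ ((true && false) && q23))) = false)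
    (h9 : ((((e0 && e1) ^^ (e2 && e3)) ^^ (true && e0)) ^^ (true && e1) ^^ (true && e2) ^^ (true && e3)) = false → (c ^^ ((true && l0) ^^ (true && l1) ^^ (true && l2) ^^ (true && l3)) ^^ (((true && true) && q01) ^^ ((true && true) && q02) ^^ ((true && true) && q03) ^^ ((true && true) && q12) ^^ ((true && true) && q13) ^^ ((true && true) && q23))) = false) :
    ∃ ε m0 m1 m2 m3 : Bool, q01 = ((ε ^^ (e0 && m1)) ^^ (e1 && m0)) ∧ q02 = ((e0 && m2) ^^ (e2 && m0)) ∧ q03 = ((e0 && m3) ^^ (e3 && m0)) ∧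
      q12 = ((e1 && m2) ^^ (e2 && m1)) ∧ q13 = ((e1 && m3) ^^ (e3 && m1)) ∧ q23 = ((ε ^^ (e2 && m3)) ^^ (e3 && m2)) :=
  ⟨_, _, _, _, _, tq0_quad_six_explicit e0 e1 e2 e3 hA c l0 l1 l2 l3 q01 q02 q03 q12 q13 q23 h0 h1 h2 h3 h4 h5 h6 h7 h8 h9⟩

end Summit.QuantumAdvantage.QuantumAdvantage.Theorems.CubicForrelation.NearExactIsExact
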